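/-
Copyright: the b2b-balaban T⁴-continuum CRUX team, row NE7b OWNER lineage `t4-ne7b-p1` (gen 130). Project licence.
-/
import Summits.QuantumFields.BalabanUV.T4Continuum.Spine.NE7b.SupEffectiveActionHessian
import Summits.QuantumFields.BalabanUV.T4Continuum.Spine.NE7b.SupEffectiveActionUpperLetter
import Summits.QuantumFields.BalabanUV.T4Continuum.Spine.NE7b.SupEffectiveActionLowerLetter

/-!
# THE HESSIAN OF THE NEXT POTENTIAL IS THE COVARIANCE FORMULA, AND THE TWO SECOND-ORDER LETTERS PIN ITS DIAGONAL — HENCE A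
# VARIANCE BOUND FOR THE TILTED LAW: at EVERY `ψ₀`, with `ν = e^{−V(ψ₀,·)}N(0,Γ)∕Z(ψ₀)`,
#   `D²(−log Z)(ψ₀)[h,k] = ⟨Σ_{p,x}w_x''h_xk_x⟩_ν − ⟨(Σw'h)(Σw'k)⟩_ν + ⟨Σw'h⟩_ν⟨Σw'k⟩_ν`   (covariance formula, (319) applied),
#   `−2λ_w·Σ_{p,x}v_x² ≤ D²(−log Z)(ψ₀)[v,v] ≤ Λ_w·Σ_{p,x}v_x²`   (the letters (318)∕(316) read on the Hessian: `t → 0⁺` in the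
#   monotonicity of the gradient along a segment), and therefore
#   `Var_ν(Σ_{p,x}w_x'(ω_x+ψ₀,x)v_x) = ⟨Σw''v²⟩_ν − D²(−log Z)[v,v] ≤ (κ₂ + 2λ_w)·Σ_{p,x}v_x²`
# — the fluctuation covariance of the remainders' gradient is bounded by the remainders' second-order constants, uniformly in the
# volume, with NO smallness used (row NE7b, node U5c; (313)∕(316)∕(318)∕(319) BY NAME; [folklore]; [cite: BrascampLieb1976, Thm 4.1]
# for the sharper convex-case inequality this does NOT prove)

Cell `pub-balaban`, sub-cell `t4`, spine estimate NE7b (`T4WeightBudget.RelWeightBound`; the cell's OWN estimate — NOT PRINTED in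
[Bałaban 1983–89], NOT PROVED).  Crux-route work under `Spine/NE7b/` by the row OWNER (`t4-ne7b-p1` gen 130, file (320)) under FREEZE
(0)'s crux-prover clause, on § [NE7bP1-G129-HANDOFF] NEXT (i) (Hessian ∕ covariance identity + the variance bound «from both letters»);
NOTHING of Bałaban's is named as a Lean object, valued or asserted; no `T4Continuum/Support` leaf typed; no `def`, no notation; zero
`sorry`.  Imports (BY NAME): the OWNER's (319) `…SupEffectiveActionHessian` (`hasFDerivAt_fderiv_neg_log_step`, `second_domination`,
`aestronglyMeasurable_cellHess`, `cellHess_apply`, `smulRight_cellDeriv_apply`), (316) `…SupEffectiveActionUpperLetter`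
(`neg_log_step_upper_letter`), (318) `…SupEffectiveActionLowerLetter` (`neg_log_step_lower_letter`), (313) (`hasFDerivAt_neg_log_step`,
`integrable_weighted_cellDeriv`, `aestronglyMeasurable_cellDeriv`, `cellDeriv_apply`, `integrable_domination`, `mul_opBound_le_of_le`),
(306) (`measurable_cellSum`, `cellSum_eq_sum_biUnion`), (297) (`integrable_exp_neg`); Mathlib's `HasFDerivAt.hasLineDerivAt`,
`HasLineDerivAt.tendsto_slope_zero_right`, `le_of_tendsto`, `ContinuousLinearMap.integral_apply`, `integral_mono`.

WHY (located).  (316)∕(318) are secant∕first-order letters; the iteration's bookkeeping wants them as bounds on the quadratic form it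
extracts (the Hessian of (319)), and the cluster-expansion side wants the fluctuation covariance of `D_ψV` controlled.  Both follow from
one elementary fact: a function with derivative everywhere and an upper (lower) second-order letter of constant `c` in a 2-homogeneous
gauge `Q` has, wherever its gradient is differentiable, second derivative `≤ 2cQ` (`≥ −2cQ`) on the diagonal — add the letter at
`(x₀, x₀+tv)` to the letter at `(x₀+tv, x₀)` and let `t → 0⁺`.  With the covariance formula, `Var_ν(Dv) = ⟨D₂vv⟩_ν − Hess[v,v]`, and
`|w''| ≤ κ₂` bounds the first term.

WHAT IS PROVED ([folklore]; notation of (319): `μ = N(0,Γ)`, `V`, `D`, `D₂`, `Z`, `G`; `Q(v) = Σ_{p∈C}Σ_{x∈cell p}v_x²`):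
* §1 THE COVARIANCE FORMULA: `integrable_weightedCellHess`, **`hessian_neg_log_step_apply`** (the Hessian of (319) applied to `h, k` equals
  `Z⁻¹∫e^{−V}(Σw''h_xk_x − (Σw'h)(Σw'k))dμ + Z⁻²(∫e^{−V}Σw'h)(∫e^{−V}Σw'k)`);
* §2 ABSTRACT (any real normed space): **`hessian_apply_le_of_upper_letter`** (`f y ≤ f x + f'x(y−x) + cQ(y−x)` everywhere, `HasFDerivAt f' H x₀`
  ⟹ `Hvv ≤ 2cQv`), **`hessian_apply_ge_of_lower_letter`** (`⟹ −2cQv ≤ Hvv`);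
* §3 THE ROAD: **`hessian_neg_log_step_le`** (under (316)'s hypotheses and `w ∈ C²`: `Hess(−log Z)(ψ₀)[v,v] ≤ Λ_w·Q(v)`),
  **`hessian_neg_log_step_ge`** (under (318)'s hypotheses and `w ∈ C²`: `−2λ_w·Q(v) ≤ Hess(−log Z)(ψ₀)[v,v]`);
* §4 THE VARIANCE BOUND **`tilted_variance_le`** (under (318)'s hypotheses, `w ∈ C²`, `|w''| ≤ κ₂`:
  `Z⁻¹∫e^{−V}(Σw'v)²dμ − (Z⁻¹∫e^{−V}Σw'v dμ)² ≤ (κ₂ + 2λ_w)·Q(v)` at EVERY `ψ₀, v`); §5 toy.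

HONEST (what this is NOT).  Not the Brascamp–Lieb inequality (which would give `Var_ν(g) ≤ ⟨∇g·(Hess)⁻¹∇g⟩_ν` with the Gaussian's own
stiffness and hence a covariance SMALL with the fluctuation scale) — only the letter-level bound `(κ₂ + 2λ_w)Q(v)`, which is `O(1)`, not
`O(ε)`: the `O(ε)` covariance bound needs the expansion (312) and is the successor's; diagonal bounds only (off-diagonal by polarisation is
not typed); positive-definite covariance for the lower side ((318)'s dictionary); scalar skeleton ((A3), NC-NE7b-α UNRULED); nothing of
Bałaban's asserted.  BY-NAME EFFECT ON THE WALL: NONE.  NE7b NOT PRINTED ∕ NOT PROVED; spine PROVED 0∕9; rung (B)+1 — the programme's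
measures remain FINITE-torus statements; NOT the mass gap, NOT Clay.  HONEST DEPENDENCY: continuum YM on T⁴ ⇐ BetaPertH ∧ nine spine
estimates (0∕9 proved); BetaPertH ⇐ (D1) ∧ (D4) ∧ CAP+tail; G-an2-4 gates asym, D1 and NE2∕3∕4.
-/

set_option autoImplicit false
set_option maxSynthPendingDepth 2

noncomputable section

namespace Summit.QuantumFields.BalabanUV.T4Continuum.NE7b.SupEffectiveActionCovariance

open MeasureTheory ProbabilityTheory Finset Real Metric Filter
open scoped BigOperators Topology Matrix
open SupEffectiveActionHessian (hasFDerivAt_fderiv_neg_log_step second_domination aestronglyMeasurable_cellHess cellHess_apply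
  smulRight_cellDeriv_apply)
open SupEffectiveActionDerivative (hasFDerivAt_neg_log_step integrable_weighted_cellDeriv aestronglyMeasurable_cellDeriv cellDeriv_apply
  integrable_domination mul_opBound_le_of_le)
open SupEffectiveActionUpperLetter (neg_log_step_upper_letter)
open SupEffectiveActionLowerLetter (neg_log_step_lower_letter)
open SupSmallFieldGasReal (measurable_cellSum cellSum_eq_sum_biUnion)
open SupFluctuationAPriori (integrable_exp_neg)

variable {ι : Type} [Fintype ι] [DecidableEq ι] {V : Type*}

/-! ## §1. The covariance formula -/

section Covariance

variable {Γ : Matrix ι ι ℝ} {γop : ℝ} {cell : V → Finset ι} {w w' w'' : ι → ℝ → ℝ} {κ₀ κ₁ κ₂ τ δ θ : ℝ}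

/-- **The weighted second derivative is Bochner integrable** (dominated on the ball, in particular at its centre). [folklore] -/
theorem integrable_weightedCellHess (hΓ : Γ.PosSemidef) (hΓop : (γop • (1 : Matrix ι ι ℝ) - Γ).PosSemidef)
    (hdisj : ∀ p q, p ≠ q → Disjoint (cell p) (cell q)) (hw' : ∀ x t, HasDerivAt (w x) (w' x t) t) (hw'm : ∀ x, Measurable (w' x))
    (hw''m : ∀ x, Measurable (w'' x)) (hκ₀ : 0 ≤ κ₀) (hκ₁ : 0 ≤ κ₁) (hτ : 0 < τ) (hδ : 0 < δ) (hθ1 : θ < 1)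
    (hκθ : (2 * κ₀ * (1 + τ) + 4 * δ) * γop ≤ θ) (hstab : ∀ x, ∀ t : ℝ, -(κ₀ * t ^ 2) ≤ w x t) (hw'b : ∀ x t, |w' x t| ≤ κ₁ * |t|)
    (hw''b : ∀ x t, |w'' x t| ≤ κ₂) (C : Finset V) (ψ₀ : EuclideanSpace ℝ ι) :
    Integrable (fun ω : EuclideanSpace ℝ ι => exp (-(∑ p ∈ C, ∑ x ∈ cell p, w x (ω x + ψ₀ x))) •
      ((∑ p ∈ C, ∑ x ∈ cell p, (w'' x (ω x + ψ₀ x)) • ((EuclideanSpace.proj x : EuclideanSpace ℝ ι →L[ℝ] ℝ).smulRight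
          (EuclideanSpace.proj x : EuclideanSpace ℝ ι →L[ℝ] ℝ))) -
        (∑ p ∈ C, ∑ x ∈ cell p, (w' x (ω x + ψ₀ x)) • (EuclideanSpace.proj x : EuclideanSpace ℝ ι →L[ℝ] ℝ)).smulRight
          (∑ p ∈ C, ∑ x ∈ cell p, (w' x (ω x + ψ₀ x)) • (EuclideanSpace.proj x : EuclideanSpace ℝ ι →L[ℝ] ℝ))))
      (multivariateGaussian 0 Γ) := by
  have hw : ∀ x, Measurable (w x) := fun x => (continuous_iff_continuousAt.2 fun t => (hw' x t).continuousAt).measurable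
  have hDm := aestronglyMeasurable_cellDeriv (multivariateGaussian 0 Γ) cell hw'm C ψ₀
  have hF'm : AEStronglyMeasurable (fun ω : EuclideanSpace ℝ ι => exp (-(∑ p ∈ C, ∑ x ∈ cell p, w x (ω x + ψ₀ x))) •
      ((∑ p ∈ C, ∑ x ∈ cell p, (w'' x (ω x + ψ₀ x)) • ((EuclideanSpace.proj x : EuclideanSpace ℝ ι →L[ℝ] ℝ).smulRight
          (EuclideanSpace.proj x : EuclideanSpace ℝ ι →L[ℝ] ℝ))) -
        (∑ p ∈ C, ∑ x ∈ cell p, (w' x (ω x + ψ₀ x)) • (EuclideanSpace.proj x : EuclideanSpace ℝ ι →L[ℝ] ℝ)).smulRight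
          (∑ p ∈ C, ∑ x ∈ cell p, (w' x (ω x + ψ₀ x)) • (EuclideanSpace.proj x : EuclideanSpace ℝ ι →L[ℝ] ℝ))))
      (multivariateGaussian 0 Γ) :=
    (continuous_exp.comp_aestronglyMeasurable (measurable_cellSum cell w hw C (fun x => ψ₀ x)).aestronglyMeasurable.neg).smul
      ((aestronglyMeasurable_cellHess _ cell hw''m C ψ₀).sub
        (isBoundedBilinearMap_smulRight.continuous.comp_aestronglyMeasurable (hDm.prodMk hDm)))
  refine (integrable_domination hΓ hΓop (C.biUnion cell) hκ₀ hτ hδ hθ1 hκθ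
      (exp (κ₀ * (1 + τ⁻¹) * (2 * ∑ x ∈ C.biUnion cell, ψ₀ x ^ 2 + 2)) *
        (κ₂ * (C.biUnion cell).card + κ₁ ^ 2 * (2 * ((C.biUnion cell).card + 2 * (2 * ∑ x ∈ C.biUnion cell, ψ₀ x ^ 2 + 2)) ^ 2 +
          4 * (δ ^ 2)⁻¹)))).mono' hF'm (ae_of_all _ fun ω => ?_)
  exact second_domination cell hdisj hκ₀ hκ₁ hτ hδ hstab hw'b hw''b C ψ₀ ψ₀ (by rw [sub_self, norm_zero]; exact zero_le_one) ω

/-- **THE HESSIAN APPLIED TO TWO DIRECTIONS IS THE COVARIANCE FORMULA**: under the hypotheses of `hasFDerivAt_tiltedNumerator`, the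
derivative of `hasFDerivAt_fderiv_neg_log_step` applied to `h, k` equals
`Z⁻¹·∫e^{−V}(Σw''_x h_xk_x − (Σw'_xh_x)(Σw'_xk_x))dμ + (Z²)⁻¹·(∫e^{−V}Σw'_xh_x dμ)(∫e^{−V}Σw'_xk_x dμ)`
(all sums over `p ∈ C`, `x ∈ cell p`, remainders at `ω_x+ψ₀,x`) — i.e. `⟨D₂hk⟩_ν − ⟨(Dh)(Dk)⟩_ν + ⟨Dh⟩_ν⟨Dk⟩_ν`. [folklore] -/
theorem hessian_neg_log_step_apply (hΓ : Γ.PosSemidef) (hΓop : (γop • (1 : Matrix ι ι ℝ) - Γ).PosSemidef)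
    (hdisj : ∀ p q, p ≠ q → Disjoint (cell p) (cell q)) (hw' : ∀ x t, HasDerivAt (w x) (w' x t) t) (hw'm : ∀ x, Measurable (w' x))
    (hw''m : ∀ x, Measurable (w'' x)) (hκ₀ : 0 ≤ κ₀) (hκ₁ : 0 ≤ κ₁) (hτ : 0 < τ) (hδ : 0 < δ) (hθ1 : θ < 1)
    (hκθ : (2 * κ₀ * (1 + τ) + 4 * δ) * γop ≤ θ) (hstab : ∀ x, ∀ t : ℝ, -(κ₀ * t ^ 2) ≤ w x t) (hw'b : ∀ x t, |w' x t| ≤ κ₁ * |t|)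
    (hw''b : ∀ x t, |w'' x t| ≤ κ₂) (C : Finset V) (ψ₀ h k : EuclideanSpace ℝ ι) :
    ((∫ ω : EuclideanSpace ℝ ι, exp (-(∑ p ∈ C, ∑ x ∈ cell p, w x (ω x + ψ₀ x))) ∂(multivariateGaussian 0 Γ))⁻¹ •
          (∫ ω : EuclideanSpace ℝ ι, exp (-(∑ p ∈ C, ∑ x ∈ cell p, w x (ω x + ψ₀ x))) •
            ((∑ p ∈ C, ∑ x ∈ cell p, (w'' x (ω x + ψ₀ x)) • ((EuclideanSpace.proj x : EuclideanSpace ℝ ι →L[ℝ] ℝ).smulRight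
                (EuclideanSpace.proj x : EuclideanSpace ℝ ι →L[ℝ] ℝ))) -
              (∑ p ∈ C, ∑ x ∈ cell p, (w' x (ω x + ψ₀ x)) • (EuclideanSpace.proj x : EuclideanSpace ℝ ι →L[ℝ] ℝ)).smulRight
                (∑ p ∈ C, ∑ x ∈ cell p, (w' x (ω x + ψ₀ x)) • (EuclideanSpace.proj x : EuclideanSpace ℝ ι →L[ℝ] ℝ)))
            ∂(multivariateGaussian 0 Γ)) +
        (((∫ ω : EuclideanSpace ℝ ι, exp (-(∑ p ∈ C, ∑ x ∈ cell p, w x (ω x + ψ₀ x))) ∂(multivariateGaussian 0 Γ)) ^ 2)⁻¹ •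
          ∫ ω : EuclideanSpace ℝ ι, exp (-(∑ p ∈ C, ∑ x ∈ cell p, w x (ω x + ψ₀ x))) •
            (∑ p ∈ C, ∑ x ∈ cell p, (w' x (ω x + ψ₀ x)) • (EuclideanSpace.proj x : EuclideanSpace ℝ ι →L[ℝ] ℝ))
            ∂(multivariateGaussian 0 Γ)).smulRight
          (∫ ω : EuclideanSpace ℝ ι, exp (-(∑ p ∈ C, ∑ x ∈ cell p, w x (ω x + ψ₀ x))) •
            (∑ p ∈ C, ∑ x ∈ cell p, (w' x (ω x + ψ₀ x)) • (EuclideanSpace.proj x : EuclideanSpace ℝ ι →L[ℝ] ℝ))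
            ∂(multivariateGaussian 0 Γ))) h k =
      (∫ ω : EuclideanSpace ℝ ι, exp (-(∑ p ∈ C, ∑ x ∈ cell p, w x (ω x + ψ₀ x))) ∂(multivariateGaussian 0 Γ))⁻¹ *
          ∫ ω : EuclideanSpace ℝ ι, exp (-(∑ p ∈ C, ∑ x ∈ cell p, w x (ω x + ψ₀ x))) *
            (∑ p ∈ C, ∑ x ∈ cell p, w'' x (ω x + ψ₀ x) * h x * k x -
              (∑ p ∈ C, ∑ x ∈ cell p, w' x (ω x + ψ₀ x) * h x) * (∑ p ∈ C, ∑ x ∈ cell p, w' x (ω x + ψ₀ x) * k x))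
            ∂(multivariateGaussian 0 Γ) +
        (((∫ ω : EuclideanSpace ℝ ι, exp (-(∑ p ∈ C, ∑ x ∈ cell p, w x (ω x + ψ₀ x))) ∂(multivariateGaussian 0 Γ)) ^ 2)⁻¹ *
          ((∫ ω : EuclideanSpace ℝ ι, exp (-(∑ p ∈ C, ∑ x ∈ cell p, w x (ω x + ψ₀ x))) *
              (∑ p ∈ C, ∑ x ∈ cell p, w' x (ω x + ψ₀ x) * h x) ∂(multivariateGaussian 0 Γ)) *
            ∫ ω : EuclideanSpace ℝ ι, exp (-(∑ p ∈ C, ∑ x ∈ cell p, w x (ω x + ψ₀ x))) *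
              (∑ p ∈ C, ∑ x ∈ cell p, w' x (ω x + ψ₀ x) * k x) ∂(multivariateGaussian 0 Γ))) := by
  have hHint := integrable_weightedCellHess hΓ hΓop hdisj hw' hw'm hw''m hκ₀ hκ₁ hτ hδ hθ1 hκθ hstab hw'b hw''b C ψ₀
  have hGint := integrable_weighted_cellDeriv hΓ hΓop hdisj hw' hw'm hκ₀ hκ₁ hτ hδ hθ1 hκθ hstab hw'b C ψ₀
  -- the first-order tilted integrals applied to a direction
  have hG : ∀ v : EuclideanSpace ℝ ι, (∫ ω : EuclideanSpace ℝ ι, exp (-(∑ p ∈ C, ∑ x ∈ cell p, w x (ω x + ψ₀ x))) •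
      (∑ p ∈ C, ∑ x ∈ cell p, (w' x (ω x + ψ₀ x)) • (EuclideanSpace.proj x : EuclideanSpace ℝ ι →L[ℝ] ℝ))
      ∂(multivariateGaussian 0 Γ)) v =
      ∫ ω : EuclideanSpace ℝ ι, exp (-(∑ p ∈ C, ∑ x ∈ cell p, w x (ω x + ψ₀ x))) *
        (∑ p ∈ C, ∑ x ∈ cell p, w' x (ω x + ψ₀ x) * v x) ∂(multivariateGaussian 0 Γ) := fun v => by
    rw [ContinuousLinearMap.integral_apply hGint]
    exact integral_congr_ae (ae_of_all _ fun ω => by simp only [_root_.smul_apply, smul_eq_mul, cellDeriv_apply])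
  -- the second-order tilted integral applied twice
  have hH1 := ContinuousLinearMap.integral_apply hHint h
  have hHint' := (ContinuousLinearMap.apply ℝ (EuclideanSpace ℝ ι →L[ℝ] ℝ) h).integrable_comp hHint
  have hH2 : (∫ ω : EuclideanSpace ℝ ι, (exp (-(∑ p ∈ C, ∑ x ∈ cell p, w x (ω x + ψ₀ x))) •
      ((∑ p ∈ C, ∑ x ∈ cell p, (w'' x (ω x + ψ₀ x)) • ((EuclideanSpace.proj x : EuclideanSpace ℝ ι →L[ℝ] ℝ).smulRight
          (EuclideanSpace.proj x : EuclideanSpace ℝ ι →L[ℝ] ℝ))) -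
        (∑ p ∈ C, ∑ x ∈ cell p, (w' x (ω x + ψ₀ x)) • (EuclideanSpace.proj x : EuclideanSpace ℝ ι →L[ℝ] ℝ)).smulRight
          (∑ p ∈ C, ∑ x ∈ cell p, (w' x (ω x + ψ₀ x)) • (EuclideanSpace.proj x : EuclideanSpace ℝ ι →L[ℝ] ℝ)))) h
      ∂(multivariateGaussian 0 Γ)) k =
      ∫ ω : EuclideanSpace ℝ ι, exp (-(∑ p ∈ C, ∑ x ∈ cell p, w x (ω x + ψ₀ x))) *
        (∑ p ∈ C, ∑ x ∈ cell p, w'' x (ω x + ψ₀ x) * h x * k x -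
          (∑ p ∈ C, ∑ x ∈ cell p, w' x (ω x + ψ₀ x) * h x) * (∑ p ∈ C, ∑ x ∈ cell p, w' x (ω x + ψ₀ x) * k x))
        ∂(multivariateGaussian 0 Γ) := by
    rw [ContinuousLinearMap.integral_apply (by exact hHint')]
    exact integral_congr_ae (ae_of_all _ fun ω => by
      simp only [_root_.smul_apply, _root_.sub_apply, smul_eq_mul, cellHess_apply, smulRight_cellDeriv_apply])
  rw [_root_.add_apply, _root_.add_apply, _root_.smul_apply, _root_.smul_apply, hH1, hH2, ContinuousLinearMap.smulRight_apply,
    _root_.smul_apply, _root_.smul_apply, hG h, hG k, smul_eq_mul, smul_eq_mul, smul_eq_mul]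
  ring

end Covariance

/-! ## §2. A second-order letter bounds the diagonal of the second derivative (abstract) -/

section Abstract

variable {E : Type*} [NormedAddCommGroup E] [NormedSpace ℝ E]

/-- **UPPER LETTER ⟹ UPPER BOUND ON THE HESSIAN'S DIAGONAL**: `f : E → ℝ` with derivative `f' x` at every `x`, the gradient map `f'`
differentiable at `x₀` with derivative `H`, `Q` 2-homogeneous (`Q(t•v) = t²Q(v)`), and the letter `f y ≤ f x + f' x (y−x) + c·Q(y−x)` for ALL
`x, y` ⟹ `H v v ≤ 2c·Q v` for every `v`: the two letters at `(x₀, x₀+tv)` and `(x₀+tv, x₀)` add up to the monotonicity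
`(f'(x₀+tv) − f'(x₀))v ≤ 2ctQ(v)`, and `t → 0⁺`. [folklore] -/
theorem hessian_apply_le_of_upper_letter {f : E → ℝ} {f' : E → E →L[ℝ] ℝ} {H : E →L[ℝ] E →L[ℝ] ℝ} {x₀ : E} {Q : E → ℝ} {c : ℝ}
    (hH : HasFDerivAt f' H x₀) (hQ : ∀ (t : ℝ) (v : E), Q (t • v) = t ^ 2 * Q v)
    (hle : ∀ x y, f y ≤ f x + f' x (y - x) + c * Q (y - x)) (v : E) : H v v ≤ 2 * c * Q v := by
  -- the slope of the gradient along `v`, evaluated at `v`, tends to `H v v` from the right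
  have hcont : Continuous fun L : E →L[ℝ] ℝ => L v := (ContinuousLinearMap.apply ℝ ℝ v).continuous
  have ht := (hcont.tendsto (H v)).comp (hH.hasLineDerivAt v).tendsto_slope_zero_right
  refine le_of_tendsto ht ?_
  filter_upwards [self_mem_nhdsWithin] with t ht0
  rw [Set.mem_Ioi] at ht0
  have h1 := hle x₀ (x₀ + t • v)
  have h2 := hle (x₀ + t • v) x₀
  rw [add_sub_cancel_left, map_smul, smul_eq_mul, hQ] at h1
  rw [sub_add_cancel_left, ← neg_smul, map_smul, smul_eq_mul, hQ, neg_sq] at h2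
  simp only [Function.comp_apply, _root_.smul_apply, _root_.sub_apply, smul_eq_mul]
  rw [inv_mul_le_iff₀ ht0]
  have hsum : t * (f' (x₀ + t • v) v - f' x₀ v) ≤ t * (t * (2 * c * Q v)) := by linarith
  exact le_of_mul_le_mul_left hsum ht0

/-- **LOWER LETTER ⟹ LOWER BOUND ON THE HESSIAN'S DIAGONAL**: as `hessian_apply_le_of_upper_letter` with the letter
`f x + f' x (y−x) − c·Q(y−x) ≤ f y` for ALL `x, y` ⟹ `−(2c·Q v) ≤ H v v`. [folklore] -/
theorem hessian_apply_ge_of_lower_letter {f : E → ℝ} {f' : E → E →L[ℝ] ℝ} {H : E →L[ℝ] E →L[ℝ] ℝ} {x₀ : E} {Q : E → ℝ} {c : ℝ}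
    (hH : HasFDerivAt f' H x₀) (hQ : ∀ (t : ℝ) (v : E), Q (t • v) = t ^ 2 * Q v)
    (hge : ∀ x y, f x + f' x (y - x) - c * Q (y - x) ≤ f y) (v : E) : -(2 * c * Q v) ≤ H v v := by
  have hcont : Continuous fun L : E →L[ℝ] ℝ => L v := (ContinuousLinearMap.apply ℝ ℝ v).continuous
  have ht := (hcont.tendsto (H v)).comp (hH.hasLineDerivAt v).tendsto_slope_zero_right
  refine ge_of_tendsto ht ?_
  filter_upwards [self_mem_nhdsWithin] with t ht0
  rw [Set.mem_Ioi] at ht0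
  have h1 := hge x₀ (x₀ + t • v)
  have h2 := hge (x₀ + t • v) x₀
  rw [add_sub_cancel_left, map_smul, smul_eq_mul, hQ] at h1
  rw [sub_add_cancel_left, ← neg_smul, map_smul, smul_eq_mul, hQ, neg_sq] at h2
  simp only [Function.comp_apply, _root_.smul_apply, _root_.sub_apply, smul_eq_mul]
  rw [le_inv_mul_iff₀ ht0]
  have hsum : t * -(2 * c * Q v) * t ≤ t * (f' (x₀ + t • v) v - f' x₀ v) := by linarith
  nlinarith

end Abstract

/-! ## §3. The road: the letters (316)∕(318) read on the Hessian of (319) -/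

omit [Fintype ι] [DecidableEq ι] in
/-- The road's gauge `Q(v) = Σ_{p∈C}Σ_{x∈cell p}v_x²` is 2-homogeneous. [folklore] -/
theorem cellSq_smul (cell : V → Finset ι) (C : Finset V) (t : ℝ) (v : EuclideanSpace ℝ ι) :
    ∑ p ∈ C, ∑ x ∈ cell p, (t • v) x ^ 2 = t ^ 2 * ∑ p ∈ C, ∑ x ∈ cell p, v x ^ 2 := by
  simp only [PiLp.smul_apply, smul_eq_mul, mul_pow, mul_sum]

section Road

variable {cell : V → Finset ι} {w w' w'' : ι → ℝ → ℝ} {κ₀ κ₁ κ₂ τ δ θ : ℝ}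

/-- **THE UPPER LETTER ON THE HESSIAN**: under the hypotheses of (316) `neg_log_step_upper_letter` (`Γ ⪰ 0`, `Γ ⪯ γ_op·1`, disjoint cells,
`w_x ∈ C¹`, `|w'| ≤ κ₁|t|`, `−κ₀t² ≤ w ≤ κ₀t²`, the upper letter of constant `Λ_w`, the regulator margins) and `w_x ∈ C²` with measurable
`|w''| ≤ κ₂`: at EVERY `ψ₀, v`, the Hessian of (319) satisfies `Hess(−log Z)(ψ₀)[v,v] ≤ Λ_w·Σ_{p∈C}Σ_{x∈cell p}v_x²`. [folklore] -/
theorem hessian_neg_log_step_le {Γ : Matrix ι ι ℝ} {γop Λw : ℝ} (hΓ : Γ.PosSemidef) (hΓop : (γop • (1 : Matrix ι ι ℝ) - Γ).PosSemidef)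
    (hdisj : ∀ p q, p ≠ q → Disjoint (cell p) (cell q)) (hw' : ∀ x t, HasDerivAt (w x) (w' x t) t)
    (hw'' : ∀ x t, HasDerivAt (w' x) (w'' x t) t) (hw'm : ∀ x, Measurable (w' x)) (hw''m : ∀ x, Measurable (w'' x))
    (hκ₀ : 0 ≤ κ₀) (hκ₁ : 0 ≤ κ₁) (hτ : 0 < τ) (hδ : 0 < δ) (hθ0 : 0 < θ) (hθ1 : θ < 1) (hκθ : (2 * κ₀ * (1 + τ) + 4 * δ) * γop ≤ θ)
    (hκθ₆ : 6 * κ₀ * (1 + τ) * γop ≤ θ) (hstab : ∀ x, ∀ t : ℝ, -(κ₀ * t ^ 2) ≤ w x t) (hquad : ∀ x, ∀ t : ℝ, w x t ≤ κ₀ * t ^ 2)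
    (hw'b : ∀ x t, |w' x t| ≤ κ₁ * |t|) (hw''b : ∀ x t, |w'' x t| ≤ κ₂)
    (hwup : ∀ x (a b : ℝ), w x b ≤ w x a + w' x a * (b - a) + Λw / 2 * (b - a) ^ 2) (C : Finset V) (ψ₀ v : EuclideanSpace ℝ ι) :
    ((∫ ω : EuclideanSpace ℝ ι, exp (-(∑ p ∈ C, ∑ x ∈ cell p, w x (ω x + ψ₀ x))) ∂(multivariateGaussian 0 Γ))⁻¹ •
          (∫ ω : EuclideanSpace ℝ ι, exp (-(∑ p ∈ C, ∑ x ∈ cell p, w x (ω x + ψ₀ x))) •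
            ((∑ p ∈ C, ∑ x ∈ cell p, (w'' x (ω x + ψ₀ x)) • ((EuclideanSpace.proj x : EuclideanSpace ℝ ι →L[ℝ] ℝ).smulRight
                (EuclideanSpace.proj x : EuclideanSpace ℝ ι →L[ℝ] ℝ))) -
              (∑ p ∈ C, ∑ x ∈ cell p, (w' x (ω x + ψ₀ x)) • (EuclideanSpace.proj x : EuclideanSpace ℝ ι →L[ℝ] ℝ)).smulRight
                (∑ p ∈ C, ∑ x ∈ cell p, (w' x (ω x + ψ₀ x)) • (EuclideanSpace.proj x : EuclideanSpace ℝ ι →L[ℝ] ℝ)))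
            ∂(multivariateGaussian 0 Γ)) +
        (((∫ ω : EuclideanSpace ℝ ι, exp (-(∑ p ∈ C, ∑ x ∈ cell p, w x (ω x + ψ₀ x))) ∂(multivariateGaussian 0 Γ)) ^ 2)⁻¹ •
          ∫ ω : EuclideanSpace ℝ ι, exp (-(∑ p ∈ C, ∑ x ∈ cell p, w x (ω x + ψ₀ x))) •
            (∑ p ∈ C, ∑ x ∈ cell p, (w' x (ω x + ψ₀ x)) • (EuclideanSpace.proj x : EuclideanSpace ℝ ι →L[ℝ] ℝ))
            ∂(multivariateGaussian 0 Γ)).smulRight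
          (∫ ω : EuclideanSpace ℝ ι, exp (-(∑ p ∈ C, ∑ x ∈ cell p, w x (ω x + ψ₀ x))) •
            (∑ p ∈ C, ∑ x ∈ cell p, (w' x (ω x + ψ₀ x)) • (EuclideanSpace.proj x : EuclideanSpace ℝ ι →L[ℝ] ℝ))
            ∂(multivariateGaussian 0 Γ))) v v ≤
      Λw * ∑ p ∈ C, ∑ x ∈ cell p, v x ^ 2 := by
  have key := hessian_apply_le_of_upper_letter (Q := fun u : EuclideanSpace ℝ ι => ∑ p ∈ C, ∑ x ∈ cell p, u x ^ 2) (c := Λw / 2)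
    (hasFDerivAt_fderiv_neg_log_step hΓ hΓop hdisj hw' hw'' hw'm hw''m hκ₀ hκ₁ hτ hδ hθ0 hθ1 hκθ hstab hw'b hw''b C ψ₀)
    (cellSq_smul cell C) (fun ψ ψ' => by
      have h := neg_log_step_upper_letter hΓ hΓop hdisj hw' hw'm hκ₀ hκ₁ hτ hδ hθ0 hθ1 hκθ hκθ₆ hstab hquad hw'b hwup C ψ ψ'
      simp only [WithLp.ofLp_sub, Pi.sub_apply]
      exact h) v
  have e : 2 * (Λw / 2) = Λw := by ring
  rw [e] at key
  exact key

/-- **THE LOWER LETTER ON THE HESSIAN**: under the hypotheses of (318) `neg_log_step_lower_letter` (`M ≻ 0` with floor `m`, `M⁻¹ ⪯ γ_op·1`,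
disjoint cells, `w_x ∈ C¹`, `|w'| ≤ κ₁|t|`, `−κ₀t² ≤ w`, the lower letter of constant `λ_w ≥ 0`, `2λ_w ≤ m`, the regulator margins) and
`w_x ∈ C²` with measurable `|w''| ≤ κ₂`: at EVERY `ψ₀, v`, `−2λ_w·Σ_{p∈C}Σ_{x∈cell p}v_x² ≤ Hess(−log Z)(ψ₀)[v,v]` (`Z` over `N(0,M⁻¹)`).
[folklore] -/
theorem hessian_neg_log_step_ge {M : Matrix ι ι ℝ} {γop m lamw : ℝ} (hM : M.PosDef)
    (hfl : ∀ z : ι → ℝ, m * ∑ i, z i ^ 2 ≤ z ⬝ᵥ (M *ᵥ z)) (hΓop : (γop • (1 : Matrix ι ι ℝ) - M⁻¹).PosSemidef)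
    (hdisj : ∀ p q, p ≠ q → Disjoint (cell p) (cell q)) (hw' : ∀ x t, HasDerivAt (w x) (w' x t) t)
    (hw'' : ∀ x t, HasDerivAt (w' x) (w'' x t) t) (hw'm : ∀ x, Measurable (w' x)) (hw''m : ∀ x, Measurable (w'' x))
    (hκ₀ : 0 ≤ κ₀) (hκ₁ : 0 ≤ κ₁) (hτ : 0 < τ) (hδ : 0 < δ) (hθ0 : 0 < θ) (hθ1 : θ < 1) (hκθ : (2 * κ₀ * (1 + τ) + 4 * δ) * γop ≤ θ)
    (hstab : ∀ x, ∀ t : ℝ, -(κ₀ * t ^ 2) ≤ w x t) (hw'b : ∀ x t, |w' x t| ≤ κ₁ * |t|) (hw''b : ∀ x t, |w'' x t| ≤ κ₂) (hlamw : 0 ≤ lamw)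
    (hwlo : ∀ u (a b : ℝ), w u a + w' u a * (b - a) - lamw / 2 * (b - a) ^ 2 ≤ w u b) (hm : 2 * lamw ≤ m) (C : Finset V)
    (ψ₀ v : EuclideanSpace ℝ ι) :
    -(2 * lamw * ∑ p ∈ C, ∑ x ∈ cell p, v x ^ 2) ≤
      ((∫ ω : EuclideanSpace ℝ ι, exp (-(∑ p ∈ C, ∑ x ∈ cell p, w x (ω x + ψ₀ x))) ∂(multivariateGaussian 0 M⁻¹))⁻¹ •
          (∫ ω : EuclideanSpace ℝ ι, exp (-(∑ p ∈ C, ∑ x ∈ cell p, w x (ω x + ψ₀ x))) •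
            ((∑ p ∈ C, ∑ x ∈ cell p, (w'' x (ω x + ψ₀ x)) • ((EuclideanSpace.proj x : EuclideanSpace ℝ ι →L[ℝ] ℝ).smulRight
                (EuclideanSpace.proj x : EuclideanSpace ℝ ι →L[ℝ] ℝ))) -
              (∑ p ∈ C, ∑ x ∈ cell p, (w' x (ω x + ψ₀ x)) • (EuclideanSpace.proj x : EuclideanSpace ℝ ι →L[ℝ] ℝ)).smulRight
                (∑ p ∈ C, ∑ x ∈ cell p, (w' x (ω x + ψ₀ x)) • (EuclideanSpace.proj x : EuclideanSpace ℝ ι →L[ℝ] ℝ)))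
            ∂(multivariateGaussian 0 M⁻¹)) +
        (((∫ ω : EuclideanSpace ℝ ι, exp (-(∑ p ∈ C, ∑ x ∈ cell p, w x (ω x + ψ₀ x))) ∂(multivariateGaussian 0 M⁻¹)) ^ 2)⁻¹ •
          ∫ ω : EuclideanSpace ℝ ι, exp (-(∑ p ∈ C, ∑ x ∈ cell p, w x (ω x + ψ₀ x))) •
            (∑ p ∈ C, ∑ x ∈ cell p, (w' x (ω x + ψ₀ x)) • (EuclideanSpace.proj x : EuclideanSpace ℝ ι →L[ℝ] ℝ))
            ∂(multivariateGaussian 0 M⁻¹)).smulRight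
          (∫ ω : EuclideanSpace ℝ ι, exp (-(∑ p ∈ C, ∑ x ∈ cell p, w x (ω x + ψ₀ x))) •
            (∑ p ∈ C, ∑ x ∈ cell p, (w' x (ω x + ψ₀ x)) • (EuclideanSpace.proj x : EuclideanSpace ℝ ι →L[ℝ] ℝ))
            ∂(multivariateGaussian 0 M⁻¹))) v v := by
  have hΓ : (M⁻¹).PosSemidef := hM.inv.posSemidef
  have key := hessian_apply_ge_of_lower_letter (Q := fun u : EuclideanSpace ℝ ι => ∑ p ∈ C, ∑ x ∈ cell p, u x ^ 2) (c := lamw)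
    (hasFDerivAt_fderiv_neg_log_step hΓ hΓop hdisj hw' hw'' hw'm hw''m hκ₀ hκ₁ hτ hδ hθ0 hθ1 hκθ hstab hw'b hw''b C ψ₀)
    (cellSq_smul cell C) (fun ψ ψ' => by
      have h := neg_log_step_lower_letter hM hfl hΓop hdisj hw' hw'm hκ₀ hκ₁ hτ hδ hθ0 hθ1 hκθ hstab hw'b hlamw hwlo hm C ψ ψ'
      simp only [WithLp.ofLp_sub, Pi.sub_apply]
      exact h) v
  have e : 2 * lamw * ∑ p ∈ C, ∑ x ∈ cell p, v x ^ 2 = 2 * lamw * (fun u : EuclideanSpace ℝ ι => ∑ p ∈ C, ∑ x ∈ cell p, u x ^ 2) v := rfl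
  rw [e]
  exact key

end Road

/-! ## §4. Toy -/

/-- Toy (§3): the gauge is 2-homogeneous on a one-cell, one-site lattice, `Q(2v) = 4Q(v)`. -/
example (v : EuclideanSpace ℝ (Fin 1)) :
    ∑ p ∈ ({()} : Finset Unit), ∑ x ∈ (fun _ : Unit => (Finset.univ : Finset (Fin 1))) p, ((2 : ℝ) • v) x ^ 2 =
      (2 : ℝ) ^ 2 * ∑ p ∈ ({()} : Finset Unit), ∑ x ∈ (fun _ : Unit => (Finset.univ : Finset (Fin 1))) p, v x ^ 2 :=
  cellSq_smul (fun _ : Unit => Finset.univ) {()} 2 v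

end Summit.QuantumFields.BalabanUV.T4Continuum.NE7b.SupEffectiveActionCovariance
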